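import Summits.RiemannHypothesis.RiemannHypothesis.Theses.NymanBeurling
import Summits.RiemannHypothesis.RiemannHypothesis.Theorems.NymanBeurlingNbThesisIntegrable
import Summits.RiemannHypothesis.RiemannHypothesis.Theorems.NymanBeurlingNbRateLog
import Literature.Barriers.RiemannHypothesis.MollifierLimitations

/-!
# RiemannHypothesis / NymanBeurling — crux #3's polynomial is the Levinson–Conrey mollifier;
what a Bettin–Conrey–Farmer rate would settle

Route `RiemannHypothesis/NymanBeurling`, crux #3 `NbMoebiusMollifier` (item
stmt-RiemannHypothesis-0395) and crux #2 `NbRateLog` (stmt-RiemannHypothesis-0394).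

* `nbMoebius_sum_eq_levinsonMollifier` — the Dirichlet polynomial of crux #3, written in the route
  file over `Fin N` as `Σ_{n<N} μ(n+1)(1 - log(n+1)/log N)(n+1)^{-s}`, is *literally* the
  Levinson–Conrey mollifier `M_N(s) = Σ_{1≤n≤N} μ(n)(1 - log n/log N) n^{-s}` of the barrier
  catalogue (`Literature.Barriers.RiemannHypothesis.levinsonMollifier`, the object of
  Radziwiłł 2012 / Bettin–Gonek 2017) — which is also Bettin–Conrey–Farmer's `V_N`
  [BettinConreyFarmer2013, display before Thm. 1]. Hence `nbMoebiusMollifier_iff_levinson`.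
* `nbMoebiusMollifier_of_tendsto` — if the real distances
  `J N := ∫ ‖1 - ζ(1/2+it) M_N(1/2+it)‖² dt/(1/4+t²)` tend to `0`, crux #3 holds (the crux only asks
  `liminf J = 0`, `nbMoebiusMollifier_iff_frequently`).
* `nb_cruxes_of_levinson_isBigO` — a rate `J N = O(1/log N)` for this ONE family of polynomials
  proves BOTH cruxes #2 and #3 (for #2 the finitely many small `N` are free,
  `nbRateLog_iff_eventually`).
* `nb_cruxes_of_levinson_isEquivalent` — in particular the exact conclusion of
  [BettinConreyFarmer2013, Thm. 1], `(1/2π) J N ~ c/log N` (there `c = 2 + γ - log 4π`, under RH and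
  their hypothesis (2) on `Σ_{|γ|≤T} |ζ'(ρ)|⁻²`), proves both cruxes. This is the precise formal
  sense in which cruxes #2/#3 are "RH + (2)"-strength from above; from below each implies RH
  (`riemannHypothesis_of_nbRateLog`, `riemannHypothesis_of_nbMoebiusMollifier`).

All statements here are unconditional implications; nothing is assumed about `ζ`.

References: S. Bettin, J. B. Conrey, D. W. Farmer, Proc. Steklov Inst. 280 (2013) = arXiv:1211.5191,
§1 and Thm. 1; S. Bettin, S. M. Gonek, Mathematika 63 (2017) §1 (the mollifier `M_N`).
-/

noncomputable section

open Complex Filter Topology MeasureTheory Asymptotics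
open scoped Real ENNReal ArithmeticFunction.Moebius

namespace Summit.RiemannHypothesis.RiemannHypothesis.Theorems

open Summit.RiemannHypothesis.RiemannHypothesis.Theses.NymanBeurling
open Literature.Barriers.RiemannHypothesis (levinsonMollifier)

/-- **Crux #3's polynomial is the Levinson–Conrey mollifier.** For every `N` and `s`,
`Σ_{n : Fin N} μ(n+1)(1 - log(n+1)/log N)(n+1)^{-s} = levinsonMollifier N s
 = Σ_{1 ≤ n ≤ N} μ(n)(1 - log n/log N) n^{-s}` (reindex `n ↦ n+1`).
[cite: BettinConreyFarmer2013, §1 (definition of V_N)] -/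
theorem nbMoebius_sum_eq_levinsonMollifier (N : ℕ) (s : ℂ) :
    ∑ n : Fin N, ((ArithmeticFunction.moebius (n + 1) : ℝ) *
        (1 - Real.log ((n : ℝ) + 1) / Real.log N) : ℂ) * ((n : ℂ) + 1) ^ (-s) =
      levinsonMollifier N s := by
  rw [levinsonMollifier, ← Finset.Ico_add_one_right_eq_Icc, Finset.sum_Ico_eq_sum_range, Nat.add_sub_cancel,
    ← Fin.sum_univ_eq_sum_range]
  refine Finset.sum_congr rfl fun n _ ↦ ?_
  rw [Nat.add_comm 1 (n : ℕ)]
  push_cast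
  ring

/-- **Crux #3 restated with the catalogued mollifier.** `NbMoebiusMollifier` says: for every
`ε > 0` there is `N` with `∫⁻ ‖1 - ζ(1/2+it) M_N(1/2+it)‖² dt/(1/4+t²) < ε`, `M_N` the
Levinson–Conrey mollifier `levinsonMollifier N` (= Bettin–Conrey–Farmer's `V_N`).
[cite: BettinConreyFarmer2013, Thm. 1 (the polynomial V_N)] -/
theorem nbMoebiusMollifier_iff_levinson :
    NbMoebiusMollifier ↔ ∀ ε : ℝ, 0 < ε → ∃ N : ℕ,
      ∫⁻ t : ℝ, ENNReal.ofReal (‖1 - riemannZeta (1 / 2 + t * I) *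
        levinsonMollifier N (1 / 2 + t * I)‖ ^ 2 / (1 / 4 + t ^ 2)) < ENNReal.ofReal ε := by
  unfold NbMoebiusMollifier
  simp only [nbMoebius_sum_eq_levinsonMollifier]

/-- The `∫⁻` of crux #3 is the `ENNReal.ofReal` of the (finite, real) Bochner integral
`J N = ∫ ‖1 - ζ(1/2+it) M_N(1/2+it)‖² dt/(1/4+t²)` (integrability: `integrable_nbIntegrand`).
[folklore] -/
theorem nbMoebius_lintegral_eq_ofReal_integral (N : ℕ) :
    ∫⁻ t : ℝ, ENNReal.ofReal (‖1 - riemannZeta (1 / 2 + t * I) *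
        levinsonMollifier N (1 / 2 + t * I)‖ ^ 2 / (1 / 4 + t ^ 2)) =
      ENNReal.ofReal (∫ t : ℝ, ‖1 - riemannZeta (1 / 2 + t * I) *
        levinsonMollifier N (1 / 2 + t * I)‖ ^ 2 / (1 / 4 + t ^ 2)) := by
  have h := nb_lintegral_eq_ofReal_integral (N := N) fun n ↦
    ((ArithmeticFunction.moebius (n + 1) : ℝ) * (1 - Real.log ((n : ℝ) + 1) / Real.log N) : ℂ)
  simpa only [nbMoebius_sum_eq_levinsonMollifier] using h

/-- The real distance `J N = ∫ ‖1 - ζ M_N‖²/(1/4+t²)` of crux #3 is integrable term-wise, hence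
`0 ≤ J N`. [folklore] -/
theorem nbMoebius_integral_nonneg (N : ℕ) :
    0 ≤ ∫ t : ℝ, ‖1 - riemannZeta (1 / 2 + t * I) *
        levinsonMollifier N (1 / 2 + t * I)‖ ^ 2 / (1 / 4 + t ^ 2) :=
  integral_nonneg fun t ↦ by positivity

/-- **A limit settles crux #3.** If `J N = ∫ ‖1 - ζ(1/2+it) M_N(1/2+it)‖² dt/(1/4+t²) → 0` along ALL
`N → ∞` (as in [BettinConreyFarmer2013, Thm. 1], conditionally), then `NbMoebiusMollifier` holds
(which asks only for `liminf_N J N = 0`, `nbMoebiusMollifier_iff_frequently`).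
[cite: BettinConreyFarmer2013, Thm. 1 (shape of the conclusion)] -/
theorem nbMoebiusMollifier_of_tendsto
    (h : Tendsto (fun N : ℕ ↦ ∫ t : ℝ, ‖1 - riemannZeta (1 / 2 + t * I) *
        levinsonMollifier N (1 / 2 + t * I)‖ ^ 2 / (1 / 4 + t ^ 2)) atTop (𝓝 0)) :
    NbMoebiusMollifier := by
  rw [nbMoebiusMollifier_iff_levinson]
  intro ε hε
  obtain ⟨N, hN⟩ := ((tendsto_order.1 h).2 ε hε).exists
  refine ⟨N, ?_⟩
  rw [nbMoebius_lintegral_eq_ofReal_integral]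
  exact (ENNReal.ofReal_lt_ofReal_iff hε).2 hN

/-- **An `O(1/log N)` rate for the Levinson–Conrey family settles both cruxes.** If
`J N = ∫ ‖1 - ζ(1/2+it) M_N(1/2+it)‖² dt/(1/4+t²) = O(1/log N)`, then crux #2 `NbRateLog` (the rate
for the infimum over all length-`N` polynomials, all `N ≥ 2`: small `N` are free by
`nbRateLog_iff_eventually`) and crux #3 `NbMoebiusMollifier` (`J N → 0`) both hold.
[cite: BettinConreyFarmer2013, Thm. 1 (shape of the conclusion)] -/
theorem nb_cruxes_of_levinson_isBigO
    (h : (fun N : ℕ ↦ ∫ t : ℝ, ‖1 - riemannZeta (1 / 2 + t * I) *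
        levinsonMollifier N (1 / 2 + t * I)‖ ^ 2 / (1 / 4 + t ^ 2)) =O[atTop]
      fun N : ℕ ↦ (Real.log (N : ℝ))⁻¹) :
    NbRateLog ∧ NbMoebiusMollifier := by
  have hlog : Tendsto (fun N : ℕ ↦ (Real.log (N : ℝ))⁻¹) atTop (𝓝 0) :=
    (Real.tendsto_log_atTop.comp tendsto_natCast_atTop_atTop).inv_tendsto_atTop
  refine ⟨?_, nbMoebiusMollifier_of_tendsto (h.trans_tendsto hlog)⟩
  rw [nbRateLog_iff_eventually]
  obtain ⟨C, hC⟩ := h.bound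
  refine ⟨C, ?_⟩
  have h2 : ∀ᶠ N : ℕ in atTop, 2 ≤ N := eventually_ge_atTop 2
  filter_upwards [hC, h2] with N hN hN2
  refine ⟨fun n ↦ ((ArithmeticFunction.moebius (n + 1) : ℝ) *
    (1 - Real.log ((n : ℝ) + 1) / Real.log N) : ℂ), ?_⟩
  simp only [nbMoebius_sum_eq_levinsonMollifier]
  rw [nbMoebius_lintegral_eq_ofReal_integral]
  refine ENNReal.ofReal_le_ofReal ?_
  have hlogpos : 0 < Real.log (N : ℝ) := Real.log_pos (by exact_mod_cast hN2)
  rw [Real.norm_of_nonneg (nbMoebius_integral_nonneg N),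
    Real.norm_of_nonneg (inv_nonneg.2 hlogpos.le)] at hN
  simpa only [div_eq_mul_inv] using hN

/-- **Bettin–Conrey–Farmer's conclusion settles both cruxes.** If, for some constant `c`,
`(1/2π) ∫ ‖1 - ζ(1/2+it) M_N(1/2+it)‖² dt/(1/4+t²) ~ c/log N` as `N → ∞` — the conclusion of
[BettinConreyFarmer2013, Thm. 1] with `c = 2 + γ - log 4π`, proved there under RH and their
hypothesis (2) `Σ_{|Im ρ|≤T} |ζ'(ρ)|⁻² ≪ T^{3/2-δ}` — then `NbRateLog` and `NbMoebiusMollifier` hold.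
So a proof of (RH ∧ (2) ⇒ BCF's asymptotic) is a proof of (RH ∧ (2) ⇒ cruxes #2 and #3); conversely
each crux implies RH (`riemannHypothesis_of_nbRateLog`, `riemannHypothesis_of_nbMoebiusMollifier`).
[cite: BettinConreyFarmer2013, Thm. 1] -/
theorem nb_cruxes_of_levinson_isEquivalent {c : ℝ}
    (h : (fun N : ℕ ↦ 1 / (2 * π) * ∫ t : ℝ, ‖1 - riemannZeta (1 / 2 + t * I) *
        levinsonMollifier N (1 / 2 + t * I)‖ ^ 2 / (1 / 4 + t ^ 2)) ~[atTop]
      fun N : ℕ ↦ c / Real.log (N : ℝ)) :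
    NbRateLog ∧ NbMoebiusMollifier := by
  refine nb_cruxes_of_levinson_isBigO ?_
  have h1 : (fun N : ℕ ↦ 1 / (2 * π) * ∫ t : ℝ, ‖1 - riemannZeta (1 / 2 + t * I) *
      levinsonMollifier N (1 / 2 + t * I)‖ ^ 2 / (1 / 4 + t ^ 2)) =O[atTop]
      fun N : ℕ ↦ (Real.log (N : ℝ))⁻¹ := by
    refine h.isBigO.trans ?_
    simpa only [div_eq_mul_inv] using
      (isBigO_const_mul_self c (fun N : ℕ ↦ (Real.log (N : ℝ))⁻¹) atTop)
  have hπ : (1 / (2 * π) : ℝ) ≠ 0 := by positivity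
  exact (isBigO_const_mul_left_iff hπ).1 h1

end Summit.RiemannHypothesis.RiemannHypothesis.Theorems

end
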